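/-
Copyright (c) 2026 the pub-hodgecm-mathlib formalisation cell (harness21).  Prover seat hodgecm-mathlib-K2Liu-p01 (g11), Track B «K2-LIT» ∕ hLiu418 #184♮, socket #41,
KIND 1 a♮ — (K1a-OF-RECORD) ED. 2: THE K1-a♮ BLOCK OF RECORD AT `n = 2` WITH THE SUPPORT LETTER PAID BY NAME (★ p864052 `hsupp_of_latticeLetters` ∘ ★ `hXW_of_tailLetters`
∘ ★ p863909 `hlatU_holds`) and the (dec) letter in ★ p863404 §2's own currency (desk K2E5-p16 (g8) WORD #12: the size∕count letters move to the `D`-currency).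
THEOREMS ONLY (no `def`, no `instance`, no notation, no named-fact hypothesis, no `sorry`).
-/
import Summits.HodgeConjecture.HodgeConjecture.Theorems.K2LiuKindOneSingularTermOfRecord       -- ★ p864122 ED. 1 (this seat): §1 `hintLoc_of_reading`, the ED. 1 head
import Summits.HodgeConjecture.HodgeConjecture.Theorems.K2LiuKindOneSingularSupportOfLetters   -- ★ p864052 ED. 2 (K2Liu-p14): `hsupp_of_latticeLetters`, `hXW_of_tailLetters`
import Summits.HodgeConjecture.HodgeConjecture.Theorems.K2LiuKindOneLineLatticeLocal           -- ★ p863909 (LH4-p18): `hlatU_holds` (the lattice letters, for every open level)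
import HarnessLib

/-!
# Crux `HLiu418`, socket #41, KIND 1 a♮ — (K1a-OF-RECORD) ED. 2 `K2LiuKindOneSingularTermOfRecordEdTwo`: THE K1-a♮ BLOCK OF RECORD, SUPPORT LETTER BY NAME

Cell `hodgecm-mathlib`, crux item hLiu418 = `stmt-HodgeConjecture-24832` (helper lane `--supports … --as helper`, count-neutral), route of record
`HCCMUnconditional`; squad K2 ∕ K2Liu, road `K2_Liu`, socket #41 `sig_K2LiuSiegelEisensteinContinuation`, KIND 1, block K1-a♮ (★ ED. 20 :133–:147).

WHAT CHANGES FROM ED. 1 (★ p864122 `K2LiuKindOneSingularTermOfRecord.exists_kindOne_singularTerm_of_record`).  Two things, both from the K1a line's words after ED. 1 was typed: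
* the (supp½) letter of ★ p863404 §2 is now PAID BY NAME with ZERO residual letters — ★ p864052 `hsupp_of_latticeLetters` (K2Liu-p14 (g5)) takes the half-plane link `hXW`
  (★ `hXW_of_tailLetters`, from §2's own letters `hsc hPT htail hsplit hA hW`) and the lattice letters for every open level (★ p863909 `K2LiuKindOneLineLatticeLocal.hlatU_holds`,
  LH4-p18 (g3)) — so ED. 1's «LATTICE» binder `Tδ δ hδ k hterm` is GONE (discharged inside);
* the K1a desk (K2E5-p16 (g8) WORD #12, 2026-09-05T01:20:29Z) RULED the currency of the `S`-dependent size∕count letters of (dec) to be the `D`-currency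
  (`∀ D ≥ 1, D·S integral → ‖factor‖ ≤ C·H^a·(1+τa S)^N·D^{N'}`, killed at the top by (supp½)), with a sibling producer `hdec_of_factorBounds_den` (K2E4-p10 (g10), in flight);
  so THIS edition takes the (dec) letter in ★ p863404 §2's OWN currency (`Na hdec` about the explicit expression of record — payable by EITHER producer at the tie), instead of
  ED. 1's `D`-free finer letters (L2)–(L5).
* **`exists_kindOne_singularTerm_of_record₂`** — socket prefix at `n = 2` VERBATIM; BY VALUE in the tie's `obtain`ed currency: (i) `T₀ G hG hsc`; (ii) ★ p863805's outputs
  `T D Pm mτ A W` + `hPT hq hP htail`; (iii) the letters in flight «ARCH-CONT» `Ac hAc hA` ((Φ-S1) R90-C131-p02), «LOC-FACE» `Gn hGn hW` (LH4-p07), the size `τa hτa` and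
  the (dec) letter `Na hdec` (★ p863488 ∕ `…_den`).  CONCLUSION = ★ p863404 §2's conclusion VERBATIM at `n = 2` (as ED. 1: `c := (∫β)⁻¹`, `I := univ`, `HT := Σ_j A·∏W`,
  `P := Σ_{k≤mτ}(ε_v q_v^{1−2s})^k`, `T'' := ↑T₀`).  Residual at the tie: `Ac hAc hA · Gn hGn hW · τa hτa · Na hdec` = 10 named tokens (`τa hτa` free).
[KudlaRallis1994, §2 (2.10)–(2.12)], [Tan1999, §3, §4 Prop. 4.8], [KudlaSweet1997, §1], [MoeglinWaldspurger1995, II.1.7, IV.1.9], [Shimura1997, §18.4 Prop. 18.14].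
HONEST LABEL.  Count-neutral helper, hypothesis-first in the in-flight letters; it closes no socket by itself: `HC_CM` is proved only modulo the 7 printed citations
(2 remaining named inputs: hLiu418 = `stmt-HodgeConjecture-24832`, h413 = `stmt-HodgeConjecture-24833`) until rung 0 closes.

## References
* [KudlaRallis1994] S. Kudla, S. Rallis, Ann. of Math. 140 (1994): §2 (2.10)–(2.12).   * [Tan1999] V. Tan, Canad. J. Math. 51 (1999): §3, §4 Prop. 4.8.
* [KudlaSweet1997] S. Kudla, W. J. Sweet, Israel J. Math. 98 (1997): §1.   * [MoeglinWaldspurger1995] C. Mœglin, J.-L. Waldspurger (1995): II.1.7, IV.1.9.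
* [Shimura1997] G. Shimura, CBMS 93 (1997): §18.4 Prop. 18.14, §20.1.   * [BorelJacquet1979] A. Borel, H. Jacquet, Corvallis I (1979): §1.2, §4.1.
-/

set_option autoImplicit false
-- the mandated namespace repeats the single-problem summit's segment (`HodgeConjecture.HodgeConjecture`)
set_option linter.dupNamespace false

noncomputable section

open scoped Matrix ENNReal NNReal Topology ComplexConjugate
open NumberField IsDedekindDomain MeasureTheory MeasureTheory.Measure Filter Set Function Metric
open Literature.NumberTheory.Automorphic Literature.NumberTheory.Automorphic.UnitaryGroup Literature.NumberTheory.GaloisRepresentations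
open Literature.NumberTheory.LFunctions
open Literature.NumberTheory.GelbartRogawski1991 Literature.NumberTheory.GelbartRogawski1991.GRConstruction
open Literature.NumberTheory.GelbartRogawski1991.UnitaryDualPair
open Literature.NumberTheory.K2Lit.SiegelDoubled Literature.MeasureTheory.Group
open Literature.NumberTheory.Automorphic.IdeleClassGroup

namespace Summit.HodgeConjecture.HodgeConjecture.Cruxes.HLiu418.K2LiuKindOneSingularTermOfRecordEdTwo

open K2LiuSiegelUnipotentFourierDefs K2LiuSiegelUnipotentCharacters K2LiuUnipotentCoveringWeight K2LiuSiegelFourierCoeffDelta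
open K2LiuQRationalDefs (IsQRationalRegularAt)
open K2LiuKindOneSingularTermPackage (exists_kindOne_singularTermPackage_of_placeLetters)
open K2LiuKindOneSingularSupportOfLetters (hsupp_of_latticeLetters hXW_of_tailLetters)
open K2LiuKindOneLineLatticeLocal (hlatU_holds)

open Classical in
/-- **(K1a-OF-RECORD) ED. 2 — THE K1-a♮ BLOCK OF RECORD AT `n = 2`, SUPPORT LETTER BY NAME.**  Socket prefix at `n = 2` VERBATIM (as ★ p863630, no `wq hwq`).  BY VALUE, in the
tie's `obtain`ed currency: (i) the bad set `T₀` of the Whittaker–Euler factorisation of record and the pole-cleared K1 scalar `G hG hsc` at `↑T₀` (★ p862613); (ii) ★ p863805's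
outputs `T D Pm mτ A W` with `hPT hq hP htail` ((c).2 (d) (e) BYTES at `c₀ := (∫β)⁻¹`); (iii) the letters in flight — «ARCH-CONT» `Ac hAc hA`, «LOC-FACE» `Gn hGn hW`, the size
`τa hτa`, and the (dec) letter `Na hdec` in ★ p863404 §2's own currency about the explicit expression of record.  The (supp½) letter is DISCHARGED INSIDE: ★
`hsupp_of_latticeLetters … (★ hXW_of_tailLetters …) (★ hlatU_holds …)`.  THEN ★ p863404 §2's conclusion VERBATIM at `n = 2` (`c := (∫β)⁻¹`, `I := univ`, `HT := Σ_j A·∏W`,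
`P := Σ_{k≤mτ S v}(ε_v q_v^{1−2s})^k`, `T'' := ↑T₀`): `∃ Eac` with the two WITNESS equations and the twelve K1-a♮ letters of ★ ED. 20 :133–:147.
[cite: KudlaRallis1994, §2 (2.10)–(2.12)] [cite: Tan1999, §3; §4 Prop. 4.8] [cite: KudlaSweet1997, §1] [cite: MoeglinWaldspurger1995, II.1.7, IV.1.9] [cite: Shimura1997, §18.4 Prop. 18.14] -/
theorem exists_kindOne_singularTerm_of_record₂
    (L : Type) [Field L] [NumberField L] [IsCMField L] (e : Fin 2 × Fin 1 ≃ Fin 2)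
    (dV : Fin 2 → L) (hdV : ∀ i, IsCMField.complexConj L (dV i) = dV i) (hdV0 : ∀ i, dV i ≠ 0)
    (dW : Fin 1 → L) (hdW : ∀ i, IsCMField.complexConj L (dW i) = dW i) (hdW0 : ∀ i, dW i ≠ 0)
    (lam : IdeleClassGroup L →ₜ* Circle) (hlam : IsConjugateSymplectic L lam) (hw : HasWeight L lam 1)
    (𝒦 : IwasawaDatum L e dV hdV dW hdW) (h𝒦 : 𝒦.IsStd) (f : ℂ → HA L e dV hdV dW hdW → ℂ)
    (hstd : IsStandardSectionFamily 𝒦 (toHeckeCharacter L lam⁻¹) f) (hcont : ∀ s, Continuous (f s))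
    [MeasurableSpace (unipDelta L e dV hdV dW hdW)] [BorelSpace (unipDelta L e dV hdV dW hdW)]
    (νN : Measure (unipDelta L e dV hdV dW hdW)) [νN.IsHaarMeasure]
    (β : unipDelta L e dV hdV dW hdW → ℝ≥0∞) (hβ : IsCoveringWeight (unipDeltaRat L e dV hdV dW hdW) β)
    (hβ0 : ∫⁻ u, β u ∂νN ≠ 0) (hβtop : ∫⁻ u, β u ∂νN ≠ ∞)
    {K : Set (unipDelta L e dV hdV dW hdW)} (hK : IsCompact K) (hβK : ∀ u, β u ≤ K.indicator 1 u)
    -- (i) the bad set of record and the pole-cleared K1 scalar of record at `↑T₀` (★ p862613 `exists_differentiableOn_sub_half_mul_scalarK1_cm`, obtained once in the tie)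
    (T₀ : Finset (HeightOneSpectrum (𝓞 (Fp L))))
    (G : ℂ → ℂ) (hG : DifferentiableOn ℂ G {s : ℂ | 0 < s.re})
    (hsc : ∀ s : ℂ, 1 / 2 < s.re →
      (s - 1 / 2) *
        (partialStandardL (T₀ : Set (HeightOneSpectrum (𝓞 (Fp L)))) (fun _ => {1}) (2 * s) /
          (partialStandardL (T₀ : Set (HeightOneSpectrum (𝓞 (Fp L)))) (fun _ => {1}) (2 * s + 1) *
            partialStandardL (T₀ : Set (HeightOneSpectrum (𝓞 (Fp L)))) (fun v => {(quadraticHeckeCharCM L).valueAtUniformizer v}) (2 * s + 2))) = G s)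
    -- (ii) ★ p863805's outputs of record (the tie's `obtain`ed names) with the four spec letters this block reads
    {m : ℕ}
    (T D Pm : skewMatrices ((IsCMField.complexConj L : L ≃ₐ[Fp L] L) : L →+* L) ((gramR L e dV hdV dW hdW).map (algebraMap (Fp L) L)) → HA L e dV hdV dW hdW →
      Finset (HeightOneSpectrum (𝓞 (Fp L))))
    (mτ : skewMatrices ((IsCMField.complexConj L : L ≃ₐ[Fp L] L) : L →+* L) ((gramR L e dV hdV dW hdW).map (algebraMap (Fp L) L)) → HeightOneSpectrum (𝓞 (Fp L)) → ℕ)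
    (A : skewMatrices ((IsCMField.complexConj L : L ≃ₐ[Fp L] L) : L →+* L) ((gramR L e dV hdV dW hdW).map (algebraMap (Fp L) L)) → Fin m → ℂ → HA L e dV hdV dW hdW → ℂ)
    (W : skewMatrices ((IsCMField.complexConj L : L ≃ₐ[Fp L] L) : L →+* L) ((gramR L e dV hdV dW hdW).map (algebraMap (Fp L) L)) → Fin m →
      HeightOneSpectrum (𝓞 (Fp L)) → ℂ → HA L e dV hdV dW hdW → ℂ)
    (hPT : ∀ S (h : HA L e dV hdV dW hdW), ∀ v ∈ Pm S h, v ∉ (T₀ : Set (HeightOneSpectrum (𝓞 (Fp L)))))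
    (hq : ∀ S (h : HA L e dV hdV dW hdW), ∀ v ∈ T S h, v.residueCard ≠ 0)
    (hP : ∀ S : skewMatrices ((IsCMField.complexConj L : L ≃ₐ[Fp L] L) : L →+* L) ((gramR L e dV hdV dW hdW).map (algebraMap (Fp L) L)),
      (S : Matrix (Fin 2) (Fin 2) L) ≠ 0 → (S : Matrix (Fin 2) (Fin 2) L).det = 0 → ∀ (h : HA L e dV hdV dW hdW), ∀ v ∈ D S h,
        DifferentiableOn ℂ (fun s : ℂ => ∑ k ∈ Finset.range (mτ S v + 1), ((quadraticHeckeCharCM L).valueAtUniformizer v * (v.residueCard : ℂ) ^ (1 - 2 * s)) ^ k)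
          {s : ℂ | 0 < s.re})
    (htail : ∀ S : skewMatrices ((IsCMField.complexConj L : L ≃ₐ[Fp L] L) : L →+* L) ((gramR L e dV hdV dW hdW).map (algebraMap (Fp L) L)),
      (S : Matrix (Fin 2) (Fin 2) L) ≠ 0 → (S : Matrix (Fin 2) (Fin 2) L).det = 0 → ∀ (s : ℂ) (h : HA L e dV hdV dW hdW), 1 < s.re →
        (((∫⁻ u, β u ∂νN).toReal⁻¹ : ℝ) : ℝ) • whittakerDelta L e dV hdV dW hdW νN (S : Matrix (Fin 2) (Fin 2) L) (f s) h =
          (((∫⁻ u, β u ∂νN).toReal⁻¹ : ℝ) : ℂ) * (∑ j, A S j s h * ∏ v ∈ T S h, W S j v s h) *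
            (partialStandardL ((T₀ : Set (HeightOneSpectrum (𝓞 (Fp L)))) ∪ (Pm S h : Set (HeightOneSpectrum (𝓞 (Fp L))))) (fun _ => {1}) (2 * s) /
              (partialStandardL ((T₀ : Set (HeightOneSpectrum (𝓞 (Fp L)))) ∪ (Pm S h : Set (HeightOneSpectrum (𝓞 (Fp L))))) (fun _ => {1}) (2 * s + 1) *
                partialStandardL ((T₀ : Set (HeightOneSpectrum (𝓞 (Fp L)))) ∪ (Pm S h : Set (HeightOneSpectrum (𝓞 (Fp L)))))
                  (fun v => {(quadraticHeckeCharCM L).valueAtUniformizer v}) (2 * s + 2))) *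
            ∏ v ∈ D S h, ∑ k ∈ Finset.range (mτ S v + 1), ((quadraticHeckeCharCM L).valueAtUniformizer v * (v.residueCard : ℂ) ^ (1 - 2 * s)) ^ k)
    -- (iii) THE LETTERS IN FLIGHT.  «ARCH-CONT»: the archimedean factors continue holomorphically to `{0 < re}` ((Φ-S1) R90-C131-p02)
    (Ac : skewMatrices ((IsCMField.complexConj L : L ≃ₐ[Fp L] L) : L →+* L) ((gramR L e dV hdV dW hdW).map (algebraMap (Fp L) L)) → Fin m → ℂ → HA L e dV hdV dW hdW → ℂ)
    (hAc : ∀ S : skewMatrices ((IsCMField.complexConj L : L ≃ₐ[Fp L] L) : L →+* L) ((gramR L e dV hdV dW hdW).map (algebraMap (Fp L) L)),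
      (S : Matrix (Fin 2) (Fin 2) L) ≠ 0 → (S : Matrix (Fin 2) (Fin 2) L).det = 0 → ∀ (h : HA L e dV hdV dW hdW) (i : Fin m),
        DifferentiableOn ℂ (fun s => Ac S i s h) {s : ℂ | 0 < s.re})
    (hA : ∀ S : skewMatrices ((IsCMField.complexConj L : L ≃ₐ[Fp L] L) : L →+* L) ((gramR L e dV hdV dW hdW).map (algebraMap (Fp L) L)),
      (S : Matrix (Fin 2) (Fin 2) L) ≠ 0 → (S : Matrix (Fin 2) (Fin 2) L).det = 0 → ∀ (h : HA L e dV hdV dW hdW) (i : Fin m) (s : ℂ), 1 < s.re → A S i s h = Ac S i s h)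
    -- «LOC-FACE»: the local factors continue to `q_v`-rational functions regular at every `s₀ ∈ {0 < re}` (LH4-p07 over ★ `exists_localFace_kindOneSingular`)
    (Gn : skewMatrices ((IsCMField.complexConj L : L ≃ₐ[Fp L] L) : L →+* L) ((gramR L e dV hdV dW hdW).map (algebraMap (Fp L) L)) → Fin m →
      HeightOneSpectrum (𝓞 (Fp L)) → ℂ → HA L e dV hdV dW hdW → ℂ)
    (hGn : ∀ S : skewMatrices ((IsCMField.complexConj L : L ≃ₐ[Fp L] L) : L →+* L) ((gramR L e dV hdV dW hdW).map (algebraMap (Fp L) L)),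
      (S : Matrix (Fin 2) (Fin 2) L) ≠ 0 → (S : Matrix (Fin 2) (Fin 2) L).det = 0 → ∀ (h : HA L e dV hdV dW hdW) (i : Fin m), ∀ v ∈ T S h,
        ∀ s₀ : ℂ, 0 < s₀.re → IsQRationalRegularAt (v.residueCard) s₀ (fun s => Gn S i v s h))
    (hW : ∀ S : skewMatrices ((IsCMField.complexConj L : L ≃ₐ[Fp L] L) : L →+* L) ((gramR L e dV hdV dW hdW).map (algebraMap (Fp L) L)),
      (S : Matrix (Fin 2) (Fin 2) L) ≠ 0 → (S : Matrix (Fin 2) (Fin 2) L).det = 0 → ∀ (h : HA L e dV hdV dW hdW) (i : Fin m), ∀ v ∈ T S h,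
        ∀ s : ℂ, 1 < s.re → W S i v s h = Gn S i v s h)
    -- the size and the (dec) letter in ★ p863404 §2's OWN currency (payer: ★ p863488 `hdec_of_factorBounds` ∕ its `D`-currency sibling `…_den` (K2E4-p10, desk WORD #12))
    (τa : skewMatrices ((IsCMField.complexConj L : L ≃ₐ[Fp L] L) : L →+* L) ((gramR L e dV hdV dW hdW).map (algebraMap (Fp L) L)) → ℝ)
    (hτa : ∀ S : skewMatrices ((IsCMField.complexConj L : L ≃ₐ[Fp L] L) : L →+* L) ((gramR L e dV hdV dW hdW).map (algebraMap (Fp L) L)),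
      ‖(fun i j => NumberField.mixedEmbedding L ((S : Matrix (Fin 2) (Fin 2) L) i j))‖ ≤ τa S)
    (Na : ℕ)
    (hdec : ∀ z : ℂ, 0 < z.re → ∃ C a b a' r : ℝ, 0 ≤ C ∧ 0 ≤ a ∧ 0 < b ∧ 0 ≤ a' ∧ 0 < r ∧
      ∀ (S : skewMatrices ((IsCMField.complexConj L : L ≃ₐ[Fp L] L) : L →+* L) ((gramR L e dV hdV dW hdW).map (algebraMap (Fp L) L))) (s : ℂ), dist s z < r →
      ∀ h : HA L e dV hdV dW hdW, (S : Matrix (Fin 2) (Fin 2) L) ≠ 0 → (S : Matrix (Fin 2) (Fin 2) L).det = 0 →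
      ‖(((∫⁻ u, β u ∂νN).toReal⁻¹ : ℝ) : ℂ) * (∑ i, Ac S i s h * ∏ v ∈ T S h, Gn S i v s h) *
          ((∏ v ∈ Pm S h, ((1 - (v.residueCard : ℂ) ^ (-(2 * s))) / ((1 - (v.residueCard : ℂ) ^ (-(2 * s + 1))) * (1 - (quadraticHeckeCharCM L).valueAtUniformizer v * (v.residueCard : ℂ) ^ (-(2 * s + 2)))))) * G s) *
          ∏ v ∈ D S h, ∑ k ∈ Finset.range (mτ S v + 1), ((quadraticHeckeCharCM L).valueAtUniformizer v * (v.residueCard : ℂ) ^ (1 - 2 * s)) ^ k‖ ≤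
        C * adelicHeightGL (2 + 2) L (h : GL (Fin (2 + 2)) (AdeleRing (𝓞 L) L)) ^ a *
          (Real.exp (-(b * adelicHeightGL (2 + 2) L (h : GL (Fin (2 + 2)) (AdeleRing (𝓞 L) L)) ^ (-a') * τa S)) * (1 + τa S) ^ Na)) :
    ∃ (Eac : skewMatrices ((IsCMField.complexConj L : L ≃ₐ[Fp L] L) : L →+* L) ((gramR L e dV hdV dW hdW).map (algebraMap (Fp L) L)) → ℂ → HA L e dV hdV dW hdW → ℂ),
      -- the WITNESS equations ((F-V) transparency; BLOCK D's row D-1 reads `hwit`)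
      (∀ (S : skewMatrices ((IsCMField.complexConj L : L ≃ₐ[Fp L] L) : L →+* L) ((gramR L e dV hdV dW hdW).map (algebraMap (Fp L) L))) (s : ℂ) (h : HA L e dV hdV dW hdW),
        (S : Matrix (Fin 2) (Fin 2) L) ≠ 0 → (S : Matrix (Fin 2) (Fin 2) L).det = 0 →
          Eac S s h = (((∫⁻ u, β u ∂νN).toReal⁻¹ : ℝ) : ℂ) * (∑ i, Ac S i s h * ∏ v ∈ T S h, Gn S i v s h) *
            ((∏ v ∈ Pm S h, ((1 - (v.residueCard : ℂ) ^ (-(2 * s))) / ((1 - (v.residueCard : ℂ) ^ (-(2 * s + 1))) * (1 - (quadraticHeckeCharCM L).valueAtUniformizer v * (v.residueCard : ℂ) ^ (-(2 * s + 2)))))) * G s) *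
            ∏ v ∈ D S h, ∑ k ∈ Finset.range (mτ S v + 1), ((quadraticHeckeCharCM L).valueAtUniformizer v * (v.residueCard : ℂ) ^ (1 - 2 * s)) ^ k) ∧
      (∀ (S : skewMatrices ((IsCMField.complexConj L : L ≃ₐ[Fp L] L) : L →+* L) ((gramR L e dV hdV dW hdW).map (algebraMap (Fp L) L))) (s : ℂ) (h : HA L e dV hdV dW hdW),
        ¬ ((S : Matrix (Fin 2) (Fin 2) L) ≠ 0 ∧ (S : Matrix (Fin 2) (Fin 2) L).det = 0) → Eac S s h = 0) ∧
      -- the twelve K1-a♮ letters of ★ ED. 20 :133–:147, token for token at `n = 2`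
      (∀ S x, DifferentiableOn ℂ (fun s => Eac S s x) {s : ℂ | 0 < s.re}) ∧
      (∀ S : skewMatrices ((IsCMField.complexConj L : L ≃ₐ[Fp L] L) : L →+* L) ((gramR L e dV hdV dW hdW).map (algebraMap (Fp L) L)),
        (S : Matrix (Fin 2) (Fin 2) L) ≠ 0 → (S : Matrix (Fin 2) (Fin 2) L).det = 0 → ∀ (s : ℂ) (h : HA L e dV hdV dW hdW), ((2 : ℕ) : ℝ) / 2 < s.re →
          (s - 1 / 2) * (((∫⁻ u, β u ∂νN).toReal⁻¹ : ℝ) • whittakerDelta L e dV hdV dW hdW νN (S : Matrix (Fin 2) (Fin 2) L) (f s) h) = Eac S s h) ∧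
      ∃ (τa : skewMatrices ((IsCMField.complexConj L : L ≃ₐ[Fp L] L) : L →+* L) ((gramR L e dV hdV dW hdW).map (algebraMap (Fp L) L)) → ℝ),
        (∀ S : skewMatrices ((IsCMField.complexConj L : L ≃ₐ[Fp L] L) : L →+* L) ((gramR L e dV hdV dW hdW).map (algebraMap (Fp L) L)),
          ‖(fun i j => NumberField.mixedEmbedding L ((S : Matrix (Fin 2) (Fin 2) L) i j))‖ ≤ τa S) ∧
        ∃ Na : ℕ,
          (∀ z : ℂ, 0 < z.re → ∃ C a c a' r : ℝ, 0 ≤ C ∧ 0 ≤ a ∧ 0 < c ∧ 0 ≤ a' ∧ 0 < r ∧ ∀ S (s : ℂ), dist s z < r → ∀ h : HA L e dV hdV dW hdW,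
            ‖Eac S s h‖ ≤ C * adelicHeightGL (2 + 2) L (h : GL (Fin (2 + 2)) (AdeleRing (𝓞 L) L)) ^ a *
              (Real.exp (-(c * adelicHeightGL (2 + 2) L (h : GL (Fin (2 + 2)) (AdeleRing (𝓞 L) L)) ^ (-a') * τa S)) * (1 + τa S) ^ Na)) ∧
          ∃ Ca κa : ℝ, 0 < Ca ∧ 0 ≤ κa ∧
            (∀ S (s : ℂ) (h : HA L e dV hdV dW hdW), 0 < s.re → Eac S s h ≠ 0 →
              ∃ D : ℕ, 1 ≤ D ∧ (D : ℝ) ≤ Ca * adelicHeightGL (2 + 2) L (h : GL (Fin (2 + 2)) (AdeleRing (𝓞 L) L)) ^ κa ∧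
                ∀ i j, IsIntegral ℤ ((D : L) * (S : Matrix (Fin 2) (Fin 2) L) i j)) := by
  -- (supp½) BY NAME: ★ p864052 from the half-plane link (§2's own identity letters) and the lattice letters for every open level (★ p863909)
  obtain ⟨Ca, κa, hCa, hκa, hsupp⟩ := hsupp_of_latticeLetters L e dV hdV dW hdW 𝒦 h𝒦 f hstd hcont νN
    (fun _ _ => ((((∫⁻ u, β u ∂νN).toReal⁻¹ : ℝ) : ℂ))) (fun _ _ => (Finset.univ : Finset (Fin m))) T Ac Gn Pm G D
    (fun S _ v s => ∑ k ∈ Finset.range (mτ S v + 1), ((quadraticHeckeCharCM L).valueAtUniformizer v * (v.residueCard : ℂ) ^ (1 - 2 * s)) ^ k)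
    (hXW_of_tailLetters L e dV hdV dW hdW f νN β (T₀ : Set (HeightOneSpectrum (𝓞 (Fp L)))) G hsc
      (fun _ _ => ((((∫⁻ u, β u ∂νN).toReal⁻¹ : ℝ) : ℂ))) D
      (fun S _ v s => ∑ k ∈ Finset.range (mτ S v + 1), ((quadraticHeckeCharCM L).valueAtUniformizer v * (v.residueCard : ℂ) ^ (1 - 2 * s)) ^ k)
      Pm hPT (fun S s h => ∑ j, A S j s h * ∏ v ∈ T S h, W S j v s h) htail
      (fun _ _ => (Finset.univ : Finset (Fin m))) T A W (fun _ _ _ _ _ _ => rfl)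
      Ac (fun S hS0 hSd h i _ s hs => hA S hS0 hSd h i s hs) Gn (fun S hS0 hSd h i _ v hv s hs => hW S hS0 hSd h i v hv s hs))
    (hlatU_holds L e dV hdV dW hdW hdV0 hdW0)
  -- ★ p863404 §2 at the letters of record
  exact exists_kindOne_singularTermPackage_of_placeLetters L e dV hdV hdV0 dW hdW hdW0 lam hlam hw 𝒦 h𝒦 f hstd hcont νN β hβ hβ0 hβtop hK hβK
    (T₀ : Set (HeightOneSpectrum (𝓞 (Fp L)))) G hG hsc
    (fun _ _ => ((((∫⁻ u, β u ∂νN).toReal⁻¹ : ℝ) : ℂ))) D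
    (fun S _ v s => ∑ k ∈ Finset.range (mτ S v + 1), ((quadraticHeckeCharCM L).valueAtUniformizer v * (v.residueCard : ℂ) ^ (1 - 2 * s)) ^ k)
    hP Pm hPT (fun S s h => ∑ j, A S j s h * ∏ v ∈ T S h, W S j v s h) htail
    (fun _ _ => (Finset.univ : Finset (Fin m))) T (fun v => v.residueCard) hq A W (fun _ _ _ _ _ _ => rfl)
    Ac (fun S hS0 hSd h i _ => hAc S hS0 hSd h i) (fun S hS0 hSd h i _ s hs => hA S hS0 hSd h i s hs)
    Gn (fun S hS0 hSd h i _ v hv s₀ hs₀ => hGn S hS0 hSd h i v hv s₀ hs₀) (fun S hS0 hSd h i _ v hv s hs => hW S hS0 hSd h i v hv s hs)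
    τa hτa Na (fun z hz => by
      obtain ⟨C, a, b, a', r, hC, ha, hb, ha', hr, hbd⟩ := hdec z hz
      exact ⟨C, a, b, a', r, hC, ha, hb, ha', hr, fun S s hs h hS0 hSd => hbd S s hs h hS0 hSd⟩) hCa hκa hsupp

end Summit.HodgeConjecture.HodgeConjecture.Cruxes.HLiu418.K2LiuKindOneSingularTermOfRecordEdTwo

end
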